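import Summits.BirchSwinnertonDyer.BirchSwinnertonDyer.Theorems.PrintCFramBottomClassIndexLawFiveLeCohenIntegralityKronecker
import Summits.BirchSwinnertonDyer.BirchSwinnertonDyer.Theorems.PrintCFramBottomClassIndexLawFiveLeFlipRungRaumCoupling
import Summits.BirchSwinnertonDyer.BirchSwinnertonDyer.Theorems.PrintCFramBottomClassIndexLawFiveLeFlipRungAllOfRungAll
import Literature.NumberTheory.Congruences.VonStaudtClausenDenominator
import HarnessLib

/-!
# Crux `PrintCFram.BottomClassIndexLawFiveLe` (stmt-BirchSwinnertonDyer-20372), line `eisenstein-resource-bdp-line` (registry v29):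
# EVERY COHEN NUMBER `H(k, n)` IS `p`-INTEGRAL AT THE SIX LEAF PRIMES — (HInt⁶) discharged; the cite road (RungAll⁶) ⟸ NF-A ∧ Raum 2023 Prop. 2.3
# (cell `bsd-print-cfram`, width seat `bsd-line-cfram-p1-w2` g15; THEOREMS ONLY, `--supports` 20372; BSD is not proved by any of this)

HONEST FRAMING. Nothing here is a statement about BSD; no registered stub is closed by this file alone. `FlipRung.rungAll_six_of_raum`
(`…FlipRungRaumCoupling`, w2 g15) derives (RungAll⁶) — the flipped rung at EVERY odd prime `q ∣ m`, level-raising primes included — from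
Cohen's Theorem 3.1 (NF-A), Raum 2023 Prop. 2.3 (`Literature…Raum2023.prop23_ramanujanCongruence_ramifiedSquareClasses`) and ONE integrality
hypothesis (HInt⁶): «for every class datum `(p, k)` of the six leaf primes, every Cohen number is `p`-integral, `‖H(k, n)‖_p ≤ 1`» (Raum's
«Fourier coefficients in `O_{K,ℓ}`» for `f = H_k`). This file DISCHARGES (HInt⁶): by Cohen's definition `H(k, 0) = −B_{2k}/(2k)` (von
Staudt–Clausen: `(p−1) ∤ 2k`, and `p ∤ 2k`), `H(k, n) = 0` off discriminants, and `H(k, n) = L(1−k, χ_D)·T_k(D, f)` at `(−1)^k n = D f²` with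
`T ∈ ℤ` and `L(1−k, χ_D)` `p`-integral for EVERY `D` of the decomposition by `CohenCut.norm_lValueDisc_le_one_of_isDisc` (`…CohenIntegralityKronecker`,
w2 g15: Carlitz/Lang with the integer Kronecker symbol, all signs and parities of `D`, `D = −p` by the exponent conditions). Hence the cite road
is unconditional given its two named facts: **`rungAll_six_of_raum_of_prints : NF-A → Raum2023.prop23 → (RungAll⁶)`**, and with
`…FlipRungAllOfRungAll` + LEAD g14's `…FlipRungAllSupply` the registry's `stub_flipRungs.1` = (FlipRungAll⁶) follows from the cite-only bundle
`stub_printsCohenKatzCusps.1` ∧ «Raum 2023 Prop. 2.3» — the EARLY discharge; the kernel road T8 (w3/w5/w6/w8) needs neither the fact nor (HInt⁶).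
§1 `norm_ratCast_cohenH_le_one` (any odd `p ≡ 3 (mod 4)`, `2 ≤ k ≤ p − 2`, `(p−1) ∤ 2k`, every `n`); §2 **`hInt_six`** = (HInt⁶) VERBATIM (the
`hInt` binder of `rungAll_six_of_raum`; the twelve `(p, k)` by `decide`-level arithmetic); §3 **`rungAll_six_of_raum_of_prints`**; §4 **`flipRungAll_six_of_prints : NF-A → Raum23 → (FlipRungAll⁶)`** = `stub_flipRungs.1` of registry v29 from the cite-only bundle.
beyond-print theorem: NO. References: [Raum2023RamanujanTypeII] Prop. 2.3; [Cohen1975] §2, Thm. 3.1; [Carlitz1959]; [Washington1997] Thm. 5.10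
(von Staudt–Clausen), Cor. 5.15.
-/

set_option autoImplicit false
-- summit-side namespace `Summit.BirchSwinnertonDyer.BirchSwinnertonDyer.…` (single-conjunct summit, D-0017 layout)
set_option linter.dupNamespace false

noncomputable section

open scoped Classical NumberTheorySymbols
open NumberField DirichletCharacter
open Literature.NumberTheory.LFunctions Literature.NumberTheory.ModularForms.CohenEisenstein Literature.NumberTheory.ModularForms
  Literature.NumberTheory.EllipticCurves Literature.NumberTheory.EllipticCurves.KrizLi2019 Literature.NumberTheory.Congruences
  Literature.NumberTheory.QuadraticFields

namespace Summit.BirchSwinnertonDyer.BirchSwinnertonDyer.Theorems.PrintCFram.CohenCut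

open Summit.BirchSwinnertonDyer.BirchSwinnertonDyer.Theorems.PrintCFram

variable {p : ℕ} [hp : Fact p.Prime]

/-! ## §1 Every Cohen number is `p`-integral -/

/-- **`‖H(k, n)‖_p ≤ 1` for every `n`** (`p ≡ 3 (mod 4)` an odd prime, `2 ≤ k ≤ p − 2`, `(p − 1) ∤ 2k`): `H(k, 0) = −B_{2k}/(2k)` by von Staudt–Clausen,
`H(k, n) = 0` off discriminants, and `H(k, n) = L(1 − k, χ_D)·T_k(D, f)` with `T ∈ ℤ` and `L(1−k, χ_D)` `p`-integral
(`norm_lValueDisc_le_one_of_isDisc`). [cite: Cohen1975, §2 (definition of H(r, N))] [cite: Washington1997, Thm. 5.10 and Cor. 5.15] -/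
theorem norm_ratCast_cohenH_le_one (hp2 : p ≠ 2) (hp4 : p % 4 = 3) {k : ℕ} (hk : 2 ≤ k) (hkp : k ≤ p - 2) (hk2 : ¬ (p - 1) ∣ 2 * k)
    (n : ℕ) : ‖((cohenH k n : ℚ) : ℚ_[p])‖ ≤ 1 := by
  have hpp : p.Prime := hp.out
  by_cases hn : n = 0
  · -- `H(k, 0) = −B_{2k}/(2k)`
    subst hn
    have hden : ¬ p ∣ (bernoulli (2 * k)).den := fun h =>
      hk2 ((VonStaudtClausen.prime_dvd_bernoulli_den_iff (by omega) hpp).mp h)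
    have hB : ‖((bernoulli (2 * k) : ℚ) : ℚ_[p])‖ ≤ 1 := Padic.norm_rat_le_one hden
    have h2k : ¬ p ∣ 2 * k := fun h => by
      rcases (Nat.Prime.dvd_mul hpp).mp h with h | h
      · exact hp2 ((Nat.prime_dvd_prime_iff_eq hpp Nat.prime_two).mp h)
      · have := Nat.le_of_dvd (by omega) h; omega
    have h2k' : ‖((2 * k : ℕ) : ℚ_[p])‖ = 1 :=
      Padic.norm_natCast_eq_one_iff.mpr ((Nat.Prime.coprime_iff_not_dvd hpp).mpr h2k)
    rw [cohenH_zero, Rat.cast_div, Rat.cast_neg, norm_div, norm_neg,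
      show ((2 * k : ℚ) : ℚ_[p]) = ((2 * k : ℕ) : ℚ_[p]) by push_cast; ring, h2k', div_one]
    exact hB
  · by_cases hdec : ∃ Df : ℤ × ℕ, IsDiscDecomposition k n Df.1 Df.2
    · obtain ⟨⟨D, f⟩, hDf⟩ := hdec
      rw [cohenH_eq hDf, Rat.cast_mul, Rat.cast_intCast, norm_mul]
      calc ‖((lValueDisc k D : ℚ) : ℚ_[p])‖ * ‖((cohenT k D f : ℤ) : ℚ_[p])‖
          ≤ 1 * 1 := by
            gcongr
            · exact norm_lValueDisc_le_one_of_isDisc hp2 hp4 hDf.1 hk hkp hk2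
            · exact Padic.norm_int_le_one _
        _ = 1 := one_mul _
    · rw [cohenH_eq_zero_of_forall hn (fun D f h => hdec ⟨(D, f), h⟩), Rat.cast_zero, norm_zero]
      exact zero_le_one

/-! ## §2 (HInt⁶): the twelve class exponents of the six leaf primes -/

/-- **(HInt⁶) — every Cohen number `H(k, n)` is `p`-integral for `p ∈ {7, 11, 19, 43, 67, 163}` and `k ∈ {(p+1)/4, (3p−1)/4}`** (the `hInt`
binder of `FlipRung.rungAll_six_of_raum` VERBATIM): at these `(p, k)` one has `2 ≤ k ≤ p − 2` and `(p − 1) ∤ 2k` (`2k ∈ {(p+1)/2, (3p−1)/2}`).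
[cite: Cohen1975, §2 (definition of H(r, N))] [cite: Washington1997, Thm. 5.10 and Cor. 5.15] -/
theorem hInt_six : ∀ (p : ℕ) [Fact p.Prime] (k : ℕ), (p = 7 ∨ p = 11 ∨ p = 19 ∨ p = 43 ∨ p = 67 ∨ p = 163) →
    (k = (p + 1) / 4 ∨ k = (3 * p - 1) / 4) → ∀ n : ℕ, ‖((cohenH k n : ℚ) : ℚ_[p])‖ ≤ 1 := by
  intro p _ k hp6 hk n
  have key : p ≠ 2 ∧ p % 4 = 3 ∧ 2 ≤ k ∧ k ≤ p - 2 ∧ ¬ (p - 1) ∣ 2 * k := by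
    rcases hp6 with rfl | rfl | rfl | rfl | rfl | rfl <;> rcases hk with rfl | rfl <;> norm_num
  exact norm_ratCast_cohenH_le_one key.1 key.2.1 key.2.2.1 key.2.2.2.1 key.2.2.2.2 n

end Summit.BirchSwinnertonDyer.BirchSwinnertonDyer.Theorems.PrintCFram.CohenCut

namespace Summit.BirchSwinnertonDyer.BirchSwinnertonDyer.Theorems.PrintCFram.FlipRung

open Summit.BirchSwinnertonDyer.BirchSwinnertonDyer.Theorems.PrintCFram

/-! ## §3 The cite road, unconditional given its two named facts -/

/-- **(RungAll⁶) ⟸ Cohen 1975 Thm 3.1 ∧ Raum 2023 Prop. 2.3** — `rungAll_six_of_raum` with (HInt⁶) discharged by `CohenCut.hInt_six`: the flipped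
rung at EVERY odd prime `q ∣ m` (level-raising primes `q ≡ −1 (mod 4p)` included) from the two cite-only facts. With
`flipRungAll_six_of_rungAll` and LEAD g14's `seedOffExc…_of_flipRungAll_of_flipRungTwo` this is the early discharge of `stub_flipRungs.1`.
[cite: Raum2023RamanujanTypeII, Prop. 2.3 (arXiv:2105.13170 p. 20)] [cite: Cohen1975, Thm. 3.1] -/
theorem rungAll_six_of_raum_of_prints (hA : Cohen1975.thm31_cohenSeries_mem_halfIntModularForms)
    (hR : Raum2023.prop23_ramanujanCongruence_ramifiedSquareClasses) :
    ∀ (p : ℕ) [Fact p.Prime] (m : ℕ) [NeZero m] (χ : DirichletCharacter ℚ_[p] m) (k : ℕ),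
      (p = 7 ∨ p = 11 ∨ p = 19 ∨ p = 43 ∨ p = 67 ∨ p = 163) →
      m.Coprime p → χ.IsPrimitive → χ.IsQuadratic → (k = (p + 1) / 4 ∨ k = (3 * p - 1) / 4) →
      2 ≤ k → k ≤ p - 2 → χ (-1) * (-1) ^ k = -1 →
      ∀ (τ : ℕ → ℤ) (q : ℕ), q.Prime → q ∣ m → q ≠ 2 →
      (∀ q' : ℕ, q'.Prime → q' ∣ m → q' ≠ 2 → (τ q' = 1 ∨ τ q' = -1)) →
      (∀ a : ℕ, m ∣ a → a / m % 4 = 3 →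
        (∀ q' : ℕ, q'.Prime → q' ∣ m → q' ≠ 2 → jacobiSym (-((a / m : ℕ) : ℤ)) q' = τ q') →
        (2 ∣ m → a / m % 8 = 7) → ¬ 3 ∣ a / m → ‖((cohenH k a : ℚ) : ℚ_[p])‖ ≤ (p : ℝ)⁻¹) →
      ∀ a : ℕ, m ∣ a → a / m % 4 = 3 →
        (∀ q' : ℕ, q'.Prime → q' ∣ m → q' ≠ 2 → jacobiSym (-((a / m : ℕ) : ℤ)) q' = (if q' = q then -τ q' else τ q')) →
        (2 ∣ m → a / m % 8 = 7) → ¬ 3 ∣ a / m → ‖((cohenH k a : ℚ) : ℚ_[p])‖ ≤ (p : ℝ)⁻¹ :=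
  rungAll_six_of_raum hA hR CohenCut.hInt_six

/-! ## §4 The early discharge of `stub_flipRungs.1`: (FlipRungAll⁶) from the two cite-only facts -/

/-- **(FlipRungAll⁶) ⟸ Cohen 1975 Thm 3.1 ∧ Raum 2023 Prop. 2.3** — the registry-v29 conjunct `stub_flipRungs.1` (the `hFlip` binder of
`FlipRung.seedOffExc_of_flipRung_of_bad` WITHOUT its flippability line, i.e. at every odd `q ∣ m`, level-raising primes included) from the
cite-only bundle: `flipRungAll_six_of_rungAll ∘ rungAll_six_of_raum_of_prints`. Feed it, with (FlipRungTwo⁶), to LEAD g14's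
`…FlipRungAllSupply`. [cite: Raum2023RamanujanTypeII, Prop. 2.3 (arXiv:2105.13170 p. 20)] [cite: Cohen1975, Thm. 3.1] -/
theorem flipRungAll_six_of_prints (hA : Cohen1975.thm31_cohenSeries_mem_halfIntModularForms)
    (hR : Raum2023.prop23_ramanujanCongruence_ramifiedSquareClasses) :
    ∀ (p : ℕ) [Fact p.Prime] (m : ℕ) [NeZero m] (χ : DirichletCharacter ℚ_[p] m) (k : ℕ),
      (p = 7 ∨ p = 11 ∨ p = 19 ∨ p = 43 ∨ p = 67 ∨ p = 163) →
      m.Coprime p → χ.IsPrimitive → χ.IsQuadratic → (k = (p + 1) / 4 ∨ k = (3 * p - 1) / 4) →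
      2 ≤ k → k ≤ p - 2 → χ (-1) * (-1) ^ k = -1 →
      ∀ (τ : ℕ → ℤ) (q : ℕ), q.Prime → q ∣ m → q ≠ 2 →
      (∀ q' : ℕ, q'.Prime → q' ∣ m → q' ≠ 2 → (τ q' = 1 ∨ τ q' = -1)) →
      (∀ (K₀ : Type) [Field K₀] [NumberField K₀] (ε₀ : DirichletCharacter ℚ_[p] (NumberField.discr K₀).natAbs),
        IsImaginaryQuadratic K₀ → Odd (NumberField.discr K₀) → NumberField.discr K₀ < -4 →
        ¬ ((3 : ℤ) ∣ NumberField.discr K₀) →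
        (∀ q' : ℕ, q'.Prime → q' ∣ m → q' ≠ 2 → jacobiSym (NumberField.discr K₀) q' = τ q') →
        (2 ∣ m → NumberField.discr K₀ % 8 = 1) → IsKroneckerCharacterOf K₀ ε₀ →
        ‖(k : ℚ_[p])⁻¹ * @generalizedBernoulli ℚ_[p] _ _
            (changeLevel (dvd_mul_right m (NumberField.discr K₀).natAbs) χ *
              changeLevel (dvd_mul_left (NumberField.discr K₀).natAbs m) ε₀).conductor ⟨conductor_ne_zero _⟩ k
            (changeLevel (dvd_mul_right m (NumberField.discr K₀).natAbs) χ *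
              changeLevel (dvd_mul_left (NumberField.discr K₀).natAbs m) ε₀).primitiveCharacter‖ ≤ (p : ℝ)⁻¹) →
      ∀ (K₀ : Type) [Field K₀] [NumberField K₀] (ε₀ : DirichletCharacter ℚ_[p] (NumberField.discr K₀).natAbs),
        IsImaginaryQuadratic K₀ → Odd (NumberField.discr K₀) → NumberField.discr K₀ < -4 →
        ¬ ((3 : ℤ) ∣ NumberField.discr K₀) →
        (∀ q' : ℕ, q'.Prime → q' ∣ m → q' ≠ 2 → jacobiSym (NumberField.discr K₀) q' = (if q' = q then -τ q' else τ q')) →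
        (2 ∣ m → NumberField.discr K₀ % 8 = 1) → IsKroneckerCharacterOf K₀ ε₀ →
        ‖(k : ℚ_[p])⁻¹ * @generalizedBernoulli ℚ_[p] _ _
            (changeLevel (dvd_mul_right m (NumberField.discr K₀).natAbs) χ *
              changeLevel (dvd_mul_left (NumberField.discr K₀).natAbs m) ε₀).conductor ⟨conductor_ne_zero _⟩ k
            (changeLevel (dvd_mul_right m (NumberField.discr K₀).natAbs) χ *
              changeLevel (dvd_mul_left (NumberField.discr K₀).natAbs m) ε₀).primitiveCharacter‖ ≤ (p : ℝ)⁻¹ :=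
  flipRungAll_six_of_rungAll (rungAll_six_of_raum_of_prints hA hR)

end Summit.BirchSwinnertonDyer.BirchSwinnertonDyer.Theorems.PrintCFram.FlipRung

end
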